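import Mathlib
import Summits.CriticalPhenomena.CardyFormulaZ2.Theorems.CardySelfRefinementGradientComparabilityStubLevelSetTransport
import HarnessLib

/-!
# Crux `GradientComparability` (stmt-CriticalPhenomena-10269), line `monotone-product-coordinates`:
# the level-set transport from the conjunct-1-free pointwise corner BET (W⁻) and the corner slope
# bound

Route `CardySelfRefinement`, sub-problem `CriticalPhenomena/CardyFormulaZ2`; vocabulary
(`P`, `Dρ`, `Dc`, `PathOK`, …) from `CardySelfRefinementDefs` (definitionally the route's
`let`-chain).

Companion of `…StubLevelSetTransportPointwise`.  There the corner BET enters in its weakest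
consumed form (W): at every band point `(ρ, c)` of the corner strip `[1-2δ, 1] × [0, 1]`,
`Dρ ≠ 0` AND every within-`[0,1]` derivative `S'` of `r ↦ Dc(r,c)/Dρ(r,c)` at `ρ` has `|S'| ≤ Θ`.
Here the non-vanishing conjunct is dropped altogether:

  (W⁻)  at every band point `(ρ, c)` of the strip: every within-`[0,1]` derivative `S'` of
        `r ↦ Dc(r,c)/Dρ(r,c)` at `ρ` has `|S'| ≤ Θ`,

and replaced by the corner clause of the first-order slope bounds (registered neighbour
`slopeBounds_corner`, taken verbatim as a hypothesis): `|Dc| ≤ C |Dρ|` on the corner level band.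
Mechanism (`levelSetTransport_corner_of_pointwise_of_slopeBound`): depth `δ := min δ_W δ_S`; at a
band point with `c ≠ 0` one has `c ∈ (0,1)` (`P(ρ,1) = 1 > vhi`, `P_one_eq_one_of_mem_Ioo`),
`Dc > 0` (`stub_Dc_pos_of_nonconstant`), so `|Dc| ≤ C |Dρ|` forces `Dρ ≠ 0` and `corner_endpoint`
applies; a band point ON the slice `c = 0` is its own slice endpoint (factor `1 ≤ e^Θ`).  The
corner patch then compares the two slice endpoints; constant `e^Θ · max Λ_P 0 · e^Θ`.

* `stub_levelSetTransport_of_pointwiseCornerBet_of_slopeBound` (registered): THE BET → (W⁻) →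
  corner slope bound → corner patch → level-set comparability; bulk half = the landed
  `levelSetTransport_bulk`.
-/

noncomputable section

namespace Summit.CriticalPhenomena.CardyFormulaZ2.Theorems.CardySelfRefinement

open scoped Topology
open Filter Set MeasureTheory
open Literature.Probability.LatticeModels Literature.Probability.Percolation
open Literature.Probability.Percolation.QuadCrossing
open Summit.CriticalPhenomena.CardyFormulaZ2.Theses.CardySelfRefinement

/-- **Corner transport from the conjunct-1-free pointwise corner BET (W⁻) plus the corner slope
bound.**  If only `|∂_ρ(Dc/Dρ)| ≤ Θ` at band points is assumed (no `Dρ ≠ 0`), the transport still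
goes through given the neighbour `slopeBounds_corner` (`|Dc| ≤ C |Dρ|` on the corner band): at band
points with `0 < c` one has `Dc > 0` (`stub_Dc_pos_of_nonconstant`, `P(ρ,1) = 1 > vhi`), hence
`Dρ ≠ 0`; a band point ON the slice `c = 0` is its own endpoint.  Depth `δ := min δ_W δ_S`. -/
theorem levelSetTransport_corner_of_pointwise_of_slopeBound
    (hCBW : ∀ k : ℕ, k = 2 ∨ k = 3 → ∀ γ : unitInterval → ℝ × ℝ, PathOK k γ →
      ∀ (m : ℕ) (F : Fin m → Quad (Set.univ : Set ℂ)), 0 < m →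
        ∃ δ : ℝ, 0 < δ ∧ δ ≤ 1 / 4 ∧ ∀ vlo vhi : ℝ, 0 < vlo → vlo < vhi → vhi < 1 →
          ∃ Θ η₁ : ℝ, 0 ≤ Θ ∧ 0 < η₁ ∧ ∀ η ∈ Set.Ioo 0 η₁, ∀ c ∈ Set.Icc (0 : ℝ) 1,
            ∀ ρ ∈ Set.Icc (1 - 2 * δ) 1, P k m F η ρ c ∈ Set.Icc vlo vhi →
              ∀ S' : ℝ, HasDerivWithinAt (fun r => Dc k m F η (r, c) / Dρ k m F η (r, c)) S'
                (Set.Icc 0 1) ρ → |S'| ≤ Θ)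
    (hSB : ∀ k : ℕ, k = 2 ∨ k = 3 → ∀ γ : unitInterval → ℝ × ℝ, PathOK k γ →
      ∀ (m : ℕ) (F : Fin m → Quad (Set.univ : Set ℂ)), 0 < m →
        ∃ δ : ℝ, 0 < δ ∧ δ ≤ 1 / 4 ∧ ∀ vlo vhi : ℝ, 0 < vlo → vlo < vhi → vhi < 1 →
          ∃ C η₁ : ℝ, 0 < η₁ ∧ ∀ η ∈ Set.Ioo 0 η₁, ∀ ρ ∈ Set.Icc (1 - 2 * δ) 1,
            ∀ c ∈ Set.Icc (0 : ℝ) 1, P k m F η ρ c ∈ Set.Icc vlo vhi →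
              |Dc k m F η (ρ, c)| ≤ C * |Dρ k m F η (ρ, c)|)
    (hCP : ∀ k : ℕ, k = 2 ∨ k = 3 → ∀ (m : ℕ) (F : Fin m → Quad (Set.univ : Set ℂ)), 0 < m →
      ∀ vlo vhi : ℝ, 0 < vlo → vlo < vhi → vhi < 1 →
        ∃ Λ η₁ : ℝ, 0 < η₁ ∧ ∀ η ∈ Set.Ioo 0 η₁,
          ∀ q ∈ Set.Icc (0 : ℝ) 1 ×ˢ Set.Icc (0 : ℝ) 1,
            ∀ q' ∈ Set.Icc (0 : ℝ) 1 ×ˢ Set.Icc (0 : ℝ) 1,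
            (q.1 = 1 ∨ q.2 = 0) → (q'.1 = 1 ∨ q'.2 = 0) →
              P k m F η q.1 q.2 ∈ Set.Icc vlo vhi → P k m F η q'.1 q'.2 ∈ Set.Icc vlo vhi →
                |Dρ k m F η q| ≤ Λ * |Dρ k m F η q'|)
    (k : ℕ) (hk : k = 2 ∨ k = 3) (γ : unitInterval → ℝ × ℝ) (hγ : PathOK k γ)
    (m : ℕ) (F : Fin m → Quad (Set.univ : Set ℂ)) (hm : 0 < m) :
    ∃ δ : ℝ, 0 < δ ∧ δ ≤ 1 / 4 ∧ ∀ vlo vhi : ℝ, 0 < vlo → vlo < vhi → vhi < 1 →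
      ∃ Λ η₁ : ℝ, 0 < η₁ ∧ ∀ η ∈ Set.Ioo 0 η₁,
        ∀ ρ₀ ∈ Set.Icc (1 - 2 * δ) 1, ∀ c₀ ∈ Set.Icc (0 : ℝ) 1,
        ∀ ρ₁ ∈ Set.Icc (1 - 2 * δ) 1, ∀ c₁ ∈ Set.Icc (0 : ℝ) 1,
          P k m F η ρ₀ c₀ ∈ Set.Icc vlo vhi → P k m F η ρ₁ c₁ = P k m F η ρ₀ c₀ →
            |Dρ k m F η (ρ₁, c₁)| ≤ Λ * |Dρ k m F η (ρ₀, c₀)| := by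
  obtain ⟨δB, hδB, hδB4, hCB'⟩ := hCBW k hk γ hγ m F hm
  obtain ⟨δS, hδS, hδS4, hSB'⟩ := hSB k hk γ hγ m F hm
  refine ⟨min δB δS, lt_min hδB hδS, (min_le_left _ _).trans hδB4,
    fun vlo vhi hvlo hvv hvhi => ?_⟩
  obtain ⟨Θ, ηT, hΘ, hηT, hT⟩ := hCB' vlo vhi hvlo hvv hvhi
  obtain ⟨C, ηS, hηS, hS0⟩ := hSB' vlo vhi hvlo hvv hvhi
  obtain ⟨ΛP, ηP, hηP, hPt⟩ := hCP k hk m F hm vlo vhi hvlo hvv hvhi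
  obtain ⟨η₇, hη₇, hP1⟩ := P_one_eq_one_of_mem_Ioo hk m F
  refine ⟨Real.exp Θ * max ΛP 0 * Real.exp Θ, min (min ηT ηS) (min ηP η₇),
    lt_min (lt_min hηT hηS) (lt_min hηP hη₇), ?_⟩
  intro η hη ρ₀ hρ₀ c₀ hc₀ ρ₁ hρ₁ c₁ hc₁ hband hlev
  have hηT' : η ∈ Set.Ioo 0 ηT :=
    ⟨hη.1, lt_of_lt_of_le hη.2 ((min_le_left _ _).trans (min_le_left _ _))⟩
  have hηS' : η ∈ Set.Ioo 0 ηS :=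
    ⟨hη.1, lt_of_lt_of_le hη.2 ((min_le_left _ _).trans (min_le_right _ _))⟩
  have hηP' : η ∈ Set.Ioo 0 ηP :=
    ⟨hη.1, lt_of_lt_of_le hη.2 ((min_le_right _ _).trans (min_le_left _ _))⟩
  have hη7' : η ∈ Set.Ioo 0 η₇ :=
    ⟨hη.1, lt_of_lt_of_le hη.2 ((min_le_right _ _).trans (min_le_right _ _))⟩
  have hη0 : η ≠ 0 := hη.1.ne'
  set v := P k m F η ρ₀ c₀ with hv
  set δ := min δB δS with hδ
  -- the polynomial `Φ` and its partials on the square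
  obtain ⟨Φ, hΦ, hPΦ⟩ := exists_contDiff_two_eq_P k m F hη0
  have hΦd : Differentiable ℝ Φ := hΦ.differentiable (by norm_num)
  have hDρ : ∀ ρ ∈ Set.Icc (0 : ℝ) 1, ∀ c ∈ Set.Icc (0 : ℝ) 1,
      Dρ k m F η (ρ, c) = fderiv ℝ Φ (ρ, c) (1, 0) := fun ρ hρ c hc =>
    derivWithin_eq_fderiv_fst (hΦd (ρ, c)) hρ (fun ρ' hρ' => hPΦ ρ' hρ' c hc)
  have hDc : ∀ ρ ∈ Set.Icc (0 : ℝ) 1, ∀ c ∈ Set.Icc (0 : ℝ) 1,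
      Dc k m F η (ρ, c) = fderiv ℝ Φ (ρ, c) (0, 1) := fun ρ hρ c hc =>
    derivWithin_eq_fderiv_snd (hΦd (ρ, c)) hc (fun c' hc' => hPΦ ρ hρ c' hc')
  have hstrip : ∀ ρ ∈ Set.Icc (1 - 2 * δ) 1,
      ρ ∈ Set.Icc (0 : ℝ) 1 ∧ ρ ∈ Set.Icc (1 - 2 * δB) 1 ∧ ρ ∈ Set.Icc (1 - 2 * δS) 1 := by
    intro ρ hρ
    have h1 : δ ≤ δB := min_le_left _ _
    have h2 : δ ≤ δS := min_le_right _ _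
    exact ⟨⟨by linarith [hρ.1], hρ.2⟩, ⟨by linarith [hρ.1], hρ.2⟩, ⟨by linarith [hρ.1], hρ.2⟩⟩
  -- `Φ_c = Dc ≥ 0` on the square (`P` is monotone in `c`)
  have hcnn : ∀ q : ℝ × ℝ, q.1 ∈ Set.Icc (0 : ℝ) 1 → q.2 ∈ Set.Icc (0 : ℝ) 1 →
      0 ≤ fderiv ℝ Φ q (0, 1) := by
    rintro ⟨ρ, c⟩ hρ hc
    rw [← hDc ρ hρ c hc]
    have hmono : Monotone fun c' => P k m F η ρ c' := fun a b h => P_mono_c k m F hη0 ρ h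
    exact (hmono.monotoneOn _).derivWithin_nonneg
  -- (W⁻) bounds `∂_ρ(Φ_c/Φ_ρ)` at the level-`v` points of the strip `[1-2δ, 1] × [0,1]`
  have hS : ∀ q : ℝ × ℝ, q.1 ∈ Set.Icc (1 - 2 * δ) 1 → q.2 ∈ Set.Icc (0 : ℝ) 1 → Φ q = v →
      ∀ S' : ℝ, HasDerivAt (fun r => fderiv ℝ Φ (r, q.2) (0, 1) / fderiv ℝ Φ (r, q.2) (1, 0))
        S' q.1 → |S'| ≤ Θ := by
    rintro ⟨ρ, c⟩ hρ hc hqv S' hS'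
    dsimp only at hρ hc hqv hS' ⊢
    obtain ⟨hρ01, hρB, -⟩ := hstrip ρ hρ
    have hPρ : P k m F η ρ c ∈ Set.Icc vlo vhi := by
      rw [hPΦ ρ hρ01 c hc, hqv]
      exact hband
    have hW : HasDerivWithinAt (fun r => Dc k m F η (r, c) / Dρ k m F η (r, c)) S'
        (Set.Icc 0 1) ρ :=
      hS'.hasDerivWithinAt.congr_of_mem (fun r hr => by rw [hDc r hr c hc, hDρ r hr c hc]) hρ01
    exact hT η hηT' c hc ρ hρB hPρ S' hW
  -- no level-`v` point on the top edge `c = 1` (`P(ρ,1) = 1 > vhi`)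
  have htop : ∀ ρ ∈ Set.Icc (1 - 2 * δ) 1, Φ (ρ, 1) ≠ v := by
    intro ρ hρ h
    have h1 := hP1 η hη7' ρ
    rw [hPΦ ρ (hstrip ρ hρ).1 1 ⟨zero_le_one, le_rfl⟩, h] at h1
    linarith [hband.2]
  -- `Φ_ρ ≠ 0` at the level-`v` points of the strip OFF the bottom edge: slope bound + `Dc > 0`
  have hne : ∀ ρ ∈ Set.Icc (1 - 2 * δ) 1, ∀ c ∈ Set.Icc (0 : ℝ) 1, c ≠ 0 → P k m F η ρ c = v →
      fderiv ℝ Φ (ρ, c) (1, 0) ≠ 0 := by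
    intro ρ hρ c hc hc0 hPv hzero
    obtain ⟨hρ01, -, hρS⟩ := hstrip ρ hρ
    have hPb : P k m F η ρ c ∈ Set.Icc vlo vhi := by
      rw [hPv]
      exact hband
    have hc1 : c ≠ 1 := by
      rintro rfl
      have h1 := hP1 η hη7' ρ
      rw [hPv] at h1
      linarith [hband.2]
    have hcI : c ∈ Set.Ioo (0 : ℝ) 1 := ⟨lt_of_le_of_ne hc.1 (Ne.symm hc0), lt_of_le_of_ne hc.2 hc1⟩
    have hpos : 0 < Dc k m F η (ρ, c) := by
      refine stub_Dc_pos_of_nonconstant k m F hη0 hρ01 hcI ?_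
      intro hconst
      have h1 := hconst 1 ⟨zero_le_one, le_rfl⟩
      rw [hP1 η hη7' ρ, hPv] at h1
      linarith [hband.2]
    have hsb := hS0 η hηS' ρ hρS c hc hPb
    rw [hDρ ρ hρ01 c hc, hzero, abs_zero, mul_zero] at hsb
    have := abs_nonneg (Dc k m F η (ρ, c))
    have h0 : Dc k m F η (ρ, c) = 0 := abs_eq_zero.1 (le_antisymm hsb this)
    linarith
  -- endpoint of the leaf through a level-`v` point of the strip (own endpoint if on `c = 0`)
  have hρlo : 0 < 1 - 2 * δ := by linarith [(min_le_left δB δS : δ ≤ δB)]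
  have hend : ∀ ρ ∈ Set.Icc (1 - 2 * δ) 1, ∀ c ∈ Set.Icc (0 : ℝ) 1, P k m F η ρ c = v →
      ∃ e : ℝ × ℝ, e.1 ∈ Set.Icc (1 - 2 * δ) 1 ∧ e.2 ∈ Set.Icc (0 : ℝ) 1 ∧ (e.1 = 1 ∨ e.2 = 0) ∧
        Φ e = v ∧ |fderiv ℝ Φ (ρ, c) (1, 0)| ≤ Real.exp Θ * |fderiv ℝ Φ e (1, 0)| ∧
        |fderiv ℝ Φ e (1, 0)| ≤ Real.exp Θ * |fderiv ℝ Φ (ρ, c) (1, 0)| := by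
    intro ρ hρ c hc hPv
    have hΦv : Φ (ρ, c) = v := by rw [← hPΦ ρ (hstrip ρ hρ).1 c hc, hPv]
    by_cases hc0 : c = 0
    · subst hc0
      have h1 : (1 : ℝ) ≤ Real.exp Θ := Real.one_le_exp hΘ
      refine ⟨(ρ, 0), hρ, hc, Or.inr rfl, hΦv, ?_, ?_⟩ <;>
        exact le_mul_of_one_le_left (abs_nonneg _) h1
    · exact corner_endpoint hΦ hρlo hΘ hcnn hS htop (q₀ := (ρ, c)) hρ hc hΦv
        (hne ρ hρ c hc hc0 hPv)
  obtain ⟨⟨e₀ρ, e₀c⟩, he₀ρ, he₀c, he₀s, he₀v, he₀1, he₀2⟩ := hend ρ₀ hρ₀ c₀ hc₀ rfl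
  obtain ⟨⟨e₁ρ, e₁c⟩, he₁ρ, he₁c, he₁s, he₁v, he₁1, he₁2⟩ := hend ρ₁ hρ₁ c₁ hc₁ hlev
  dsimp only at he₀ρ he₀c he₀s he₀v he₀1 he₀2 he₁ρ he₁c he₁s he₁v he₁1 he₁2
  -- the patch compares the endpoints
  have hPe₀ : P k m F η e₀ρ e₀c ∈ Set.Icc vlo vhi := by
    rw [hPΦ e₀ρ (hstrip e₀ρ he₀ρ).1 e₀c he₀c, he₀v]
    exact hband
  have hPe₁ : P k m F η e₁ρ e₁c ∈ Set.Icc vlo vhi := by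
    rw [hPΦ e₁ρ (hstrip e₁ρ he₁ρ).1 e₁c he₁c, he₁v]
    exact hband
  have hpatch := hPt η hηP' (e₁ρ, e₁c) ⟨(hstrip e₁ρ he₁ρ).1, he₁c⟩ (e₀ρ, e₀c)
    ⟨(hstrip e₀ρ he₀ρ).1, he₀c⟩ he₁s he₀s hPe₁ hPe₀
  rw [hDρ e₁ρ (hstrip e₁ρ he₁ρ).1 e₁c he₁c, hDρ e₀ρ (hstrip e₀ρ he₀ρ).1 e₀c he₀c] at hpatch
  rw [hDρ ρ₁ (hstrip ρ₁ hρ₁).1 c₁ hc₁, hDρ ρ₀ (hstrip ρ₀ hρ₀).1 c₀ hc₀]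
  calc |fderiv ℝ Φ (ρ₁, c₁) (1, 0)| ≤ Real.exp Θ * |fderiv ℝ Φ (e₁ρ, e₁c) (1, 0)| := he₁1
    _ ≤ Real.exp Θ * (max ΛP 0 * |fderiv ℝ Φ (e₀ρ, e₀c) (1, 0)|) := by
        gcongr
        exact hpatch.trans (mul_le_mul_of_nonneg_right (le_max_left _ _) (abs_nonneg _))
    _ ≤ Real.exp Θ * (max ΛP 0 * (Real.exp Θ * |fderiv ℝ Φ (ρ₀, c₀) (1, 0)|)) := by
        gcongr
    _ = Real.exp Θ * max ΛP 0 * Real.exp Θ * |fderiv ℝ Φ (ρ₀, c₀) (1, 0)| := by ring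

/-- **Level-set transport from the conjunct-1-free pointwise corner BET and the corner slope bound
(registered helper `stub_levelSetTransport_of_pointwiseCornerBet_of_slopeBound`)** of line
`monotone-product-coordinates` (crux `GradientComparability`): THE BET, (W⁻) (`|∂_ρ(Dc/Dρ)| ≤ Θ` at
band points of the corner strip, no non-vanishing clause), the corner slope bound `|Dc| ≤ C |Dρ|`
on the corner level band and the corner patch imply the LEVEL-SET COMPARABILITY of the Russo
gradient (bulk: the landed `levelSetTransport_bulk`; corner, for the depth `min δ_W δ_S`:
`levelSetTransport_corner_of_pointwise_of_slopeBound`), mesh-uniformly. -/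
theorem stub_levelSetTransport_of_pointwiseCornerBet_of_slopeBound :
    (∀ k : ℕ, k = 2 ∨ k = 3 → ∀ γ : unitInterval → ℝ × ℝ, PathOK k γ → ∀ (m : ℕ) (F : Fin m → Quad
    (Set.univ : Set ℂ)), 0 < m → ∀ δ : ℝ, 0 < δ → δ ≤ 1 / 2 → ∀ vlo vhi : ℝ, 0 < vlo → vlo < vhi →
    vhi < 1 → ∃ Θ η₁ : ℝ, 0 ≤ Θ ∧ 0 < η₁ ∧ ∀ η ∈ Set.Ioo 0 η₁, ∀ ρ ∈ Set.Icc (0 : ℝ) (1 - δ), ∀ c ∈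
    Set.Icc (0 : ℝ) 1, ∀ c' ∈ Set.Icc (0 : ℝ) 1, P k m F η ρ c ∈ Set.Icc vlo vhi → P k m F η ρ c' ∈
    Set.Icc vlo vhi → |Dρ k m F η (ρ, c) / Dc k m F η (ρ, c) - Dρ k m F η (ρ, c') / Dc k m F η (ρ,
    c')| ≤ Θ * |c - c'|) → (∀ k : ℕ, k = 2 ∨ k = 3 → ∀ γ : unitInterval → ℝ × ℝ, PathOK k γ → ∀ (m :
    ℕ) (F : Fin m → Quad (Set.univ : Set ℂ)), 0 < m → ∃ δ : ℝ, 0 < δ ∧ δ ≤ 1 / 4 ∧ ∀ vlo vhi : ℝ, 0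
    < vlo → vlo < vhi → vhi < 1 → ∃ Θ η₁ : ℝ, 0 ≤ Θ ∧ 0 < η₁ ∧ ∀ η ∈ Set.Ioo 0 η₁, ∀ c ∈ Set.Icc (0
    : ℝ) 1, ∀ ρ ∈ Set.Icc (1 - 2 * δ) 1, P k m F η ρ c ∈ Set.Icc vlo vhi → ∀ S' : ℝ,
    HasDerivWithinAt (fun r => Dc k m F η (r, c) / Dρ k m F η (r, c)) S' (Set.Icc 0 1) ρ → |S'| ≤ Θ)
    → (∀ k : ℕ, k = 2 ∨ k = 3 → ∀ γ : unitInterval → ℝ × ℝ, PathOK k γ → ∀ (m : ℕ) (F : Fin m → Quad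
    (Set.univ : Set ℂ)), 0 < m → ∃ δ : ℝ, 0 < δ ∧ δ ≤ 1 / 4 ∧ ∀ vlo vhi : ℝ, 0 < vlo → vlo < vhi →
    vhi < 1 → ∃ C η₁ : ℝ, 0 < η₁ ∧ ∀ η ∈ Set.Ioo 0 η₁, ∀ ρ ∈ Set.Icc (1 - 2 * δ) 1, ∀ c ∈ Set.Icc (0
    : ℝ) 1, P k m F η ρ c ∈ Set.Icc vlo vhi → |Dc k m F η (ρ, c)| ≤ C * |Dρ k m F η (ρ, c)|) → (∀ k
    : ℕ, k = 2 ∨ k = 3 → ∀ (m : ℕ) (F : Fin m → Quad (Set.univ : Set ℂ)), 0 < m → ∀ vlo vhi : ℝ, 0 <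
    vlo → vlo < vhi → vhi < 1 → ∃ Λ η₁ : ℝ, 0 < η₁ ∧ ∀ η ∈ Set.Ioo 0 η₁, ∀ q ∈ Set.Icc (0 : ℝ) 1 ×ˢ
    Set.Icc (0 : ℝ) 1, ∀ q' ∈ Set.Icc (0 : ℝ) 1 ×ˢ Set.Icc (0 : ℝ) 1, (q.1 = 1 ∨ q.2 = 0) → (q'.1 =
    1 ∨ q'.2 = 0) → P k m F η q.1 q.2 ∈ Set.Icc vlo vhi → P k m F η q'.1 q'.2 ∈ Set.Icc vlo vhi →
    |Dρ k m F η q| ≤ Λ * |Dρ k m F η q'|) → ∀ k : ℕ, k = 2 ∨ k = 3 → ∀ γ : unitInterval → ℝ × ℝ,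
    PathOK k γ → ∀ (m : ℕ) (F : Fin m → Quad (Set.univ : Set ℂ)), 0 < m → (∀ δ : ℝ, 0 < δ → δ ≤ 1 /
    2 → ∀ vlo vhi : ℝ, 0 < vlo → vlo < vhi → vhi < 1 → ∃ Λ η₁ : ℝ, 0 < η₁ ∧ ∀ η ∈ Set.Ioo 0 η₁, ∀ ρ₀
    ∈ Set.Icc (0 : ℝ) (1 - δ), ∀ c₀ ∈ Set.Icc (0 : ℝ) 1, ∀ ρ₁ ∈ Set.Icc (0 : ℝ) (1 - δ), ∀ c₁ ∈
    Set.Icc (0 : ℝ) 1, P k m F η ρ₀ c₀ ∈ Set.Icc vlo vhi → P k m F η ρ₁ c₁ = P k m F η ρ₀ c₀ → Dc k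
    m F η (ρ₁, c₁) ≤ Λ * Dc k m F η (ρ₀, c₀)) ∧ (∃ δ : ℝ, 0 < δ ∧ δ ≤ 1 / 4 ∧ ∀ vlo vhi : ℝ, 0 < vlo
    → vlo < vhi → vhi < 1 → ∃ Λ η₁ : ℝ, 0 < η₁ ∧ ∀ η ∈ Set.Ioo 0 η₁, ∀ ρ₀ ∈ Set.Icc (1 - 2 * δ) 1, ∀
    c₀ ∈ Set.Icc (0 : ℝ) 1, ∀ ρ₁ ∈ Set.Icc (1 - 2 * δ) 1, ∀ c₁ ∈ Set.Icc (0 : ℝ) 1, P k m F η ρ₀ c₀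
    ∈ Set.Icc vlo vhi → P k m F η ρ₁ c₁ = P k m F η ρ₀ c₀ → |Dρ k m F η (ρ₁, c₁)| ≤ Λ * |Dρ k m F η
    (ρ₀, c₀)|) := by
  intro hBET hCBW hSB hCP k hk γ hγ m F hm
  exact ⟨levelSetTransport_bulk hBET k hk γ hγ m F hm,
    levelSetTransport_corner_of_pointwise_of_slopeBound hCBW hSB hCP k hk γ hγ m F hm⟩

end Summit.CriticalPhenomena.CardyFormulaZ2.Theorems.CardySelfRefinement

end
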